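import Literature.MathematicalPhysics.QuantumFieldTheory.Balaban1983to89.B6Prop26PrintedStage2KLevelV1
import Literature.MathematicalPhysics.QuantumFieldTheory.Balaban1983to89.B6Grad2NormSuppLegKLevelV1
import HarnessLib

/-!
# `Balaban1983to89.B6Prop26HolderGrad2KLevelV1` — T. Bałaban, *Propagators and renormalization transformations for lattice gauge theories. II*,
Comm. Math. Phys. **96** (1984) 223–250 [Balaban1984PropagatorsII], Prop. 2.6 (2.138)/(2.139) p. 247 with (2.141) p. 247 and (2.91) p. 239:
**THE (2.141) WALK FOR THE TWO-DIFFERENCE ENTRY `∇G∇*` ON THE HÖLDER INPUT CLASS, AT k LEVELS, IN THE FORM `P·G·D′ = P·G₀·D′ + (P·G)(R·D′)`** —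
for the genuine `G = Δ_a⁻¹` of the V1 torus family, ANY left factor `P` (`∇_ν` for (2.138), `P_{x,x′}·∇_ν` for the Hölder quotient (2.139)) and ANY right
factor `D′` (`∇*_μ`), with the fixed point `G = G₀ + GR` of (2.91)/(2.141) taken at the genuine cubes of `…B6CubeWindowV1` EXACTLY as in r03's
`…B6Prop26KLevelSkeletonV2.prop26_2136_kLevel_skeleton₂` (`eq291` + `hagree_cube`/`hinvl_cube` + `onFun_GE_mul_deltaAE` + `fixedPoint_of_291`).

HONEST FRAMING (programme rule): statement-level skeleton of published theorems with citation tags; proofs where landed; nothing here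
is a claim about the Yang–Mills mass gap.

PRINT (p. 247 [PDF 25], verbatim): «|(∇G∇*J)(x)| ≤ O(1)e^{−δ₃d(y,y′)}(‖J‖^{ξ′}_ε + |J|) (2.138) … ‖ζ∇G∇*J‖_α ≤ O(1)(L^jη)^{−α}(‖ζ‖^ξ_α + |ζ|)e^{−δ₃d(y,y′)}
(‖J‖^{ξ′}_{α+ε} + |J|) (2.139) … The operator G can be represented as G = G₀(I − R)⁻¹ = Σ_{n=0}^∞ G₀Rⁿ = … (2.141) and the series above is convergent in the
norms appearing in the inequalities (2.136)–(2.140).»  OUR READING (p27's `…B6RandomWalkInputNormChain` §3): through `G = G₀ + GR` the two-difference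
entry is ONE sum over cubes and ONE composition, `P·G·D′ = Σ_□ P·h_□G_□h_□·D′ + (P·G)·(R·D′)`; the Hölder norm of the input enters only through the last
factor `D′` (the n = 0 legs and the last legs `R·D′`), the left letter `P·G` is a sup letter ((2.136)₂ resp. (2.137)₁), the two kernels convolve by
Lemma 2.1 (2.63) and the input-block length of the last legs is carried to the output block by the level-gap transport of p38's `len_le_of_levelGap`.

## WHAT THIS FILE CERTIFIES (kernel-checked, sorry-free, standard axioms; THEOREMS ONLY — no `def`, no `def … : Prop`)

* §1 `hasMajorantA_sum_overlap_in` — bounded-overlap gluing on the INPUT indicator (`Σ_□ 1_{S_□}(y′)·K ≤ N·K`), the twin of p27's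
  `hasMajorantA_sum_overlap`; `card_filter_ST_le` — every torus block lies in at most `3·9^{d+1}` of the reach sets `Q^T_□` (p21/r03's `□̃`-count
  `card_filter_mem_QbigT_le` and `□⁺ ⊆ □̃`).
* §2 **`pairWalk_kLevel`** — ON ONE ADMISSIBLE V1 TORUS (`k ≥ 2`, `M_h = Lᵃ ≥ 8`, `R ≥ 2L²`, `P′ ≥ 5`, `L ≥ 5`, cubes placed, `c′ ≠ 0`, positive weights
  in the global band), for ANY admissible-input class `adm` (sizes `≥ 0`), ANY left factor `P` and right factor `D′` and a nonnegative weight `t`: IF the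
  n = 0 legs satisfy `P·h_□G_□h_□·D′ ≺_adm 1_{Q_□}(y′)·C₀·t·e^{−ρd}` for every cube, the left letter `P·G ≺ A_S·t·(Lʲ⁽ʸ⁾|c′|⁻¹)·e^{−ρd}` (sup class) and
  the last legs `R·D′ ≺_adm θ·(L^{j(y′)}|c′|⁻¹)⁻¹·e^{−ρd}`, THEN `P·G·D′ ≺_adm (3·9^{d+1}·C₀ + A_S·θ·c²·L)·t·e^{−(ρ/2 − τ/2)d}` under the Lemma-2.1 budget
  `(N₀, ρ, ½)` and the transport budget `2 log L ≤ τ(R·L·M_h − 1)` (`c = K261 N₀ (d+1) L 1 (ρ/2)`) — NO smallness (it is spent inside the sup letter).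
* §3 **`holderGrad2_pair_kLevel_census`** — THE PAIR MAJORANT OF `∇_νG∇*_μ` ON THE HÖLDER CLASS `‖·‖_{α+ε} + |·|` in the census shape consumed by
  `…B6Prop26Census2139KLevelV1.prop26_census2139_kLevel_of_pair` (its `hp4`, CHARACTER FOR CHARACTER): from §2 with `P := P_{x,x′}·∇_ν`, `D′ := ∇*_μ`,
  `t := t(x,x′)^α`, the left letter BY NAME = r03/p22's `…B6Cor28HolderUnifKLevelV1.ineq2137_grad_kLevel_unif` ((2.137)₁ at k levels), the Lemma-2.1 and
  transport budgets chosen inside (`N₀`, `τ := ρ/2`, rate `ρ/4`), and TWO DISPLAYED k-level inputs: (hlegs0) the per-cube Hölder-output n = 0 legs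
  `P_{x,x′}·∇_μ(h_□G_□h_□)∇*_ν` on the class (the (1.113) member of [Balaban1984PropagatorsI] through the window — file `…B6HolderGrad2NormSuppLegKLevelV1`
  of this seat) and (hlast) the last legs `R·∇*_μ` on the class `‖·‖_{ε′} + |·|` (the (1.112) letters of the pairs `K_{□,□′}G_{□′}h_{□′}∇*` — the SAME input
  the (2.138) census assembly consumes).

## HONEST SCOPE

(1) Bookkeeping of the walk only: the analytic inputs (hlegs0), (hlast) are DISPLAYED hypothesis binders; (2.137)₁ and Lemma 2.1 enter by name.
(2) Thresholds/rates chosen once for the band, before the exponents; constants depend on `d, L, b₀, b₁, α, ε`.  (3) V1 torus family, lattice units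
(`η = |c′|⁻¹`), census sub-case `supp J ⊂ Δ(y′)` (GAPS G-B6-2138-SUPP).  NOT summit progress.  Unit `pub-ymgap-dag-n02-b` (Track-A seat, D-0062; slot c4
of node N03), 2026-08-25.
-/

noncomputable section

open scoped BigOperators
open Finset

namespace Literature.MathematicalPhysics.QuantumFieldTheory.Balaban1983to89.B6Prop26HolderGrad2KLevelV1

open LatticeFieldCalculus
open B6MultiLevelBoxOperator (N0)
open B6MultiLevelTorusOperator (TDomains)
open B6Cover236MultiLevelBlocks (cubes)
open B6Geom246MultiLevelBox (bset)
open B6Geom246MultiLevelTorus (geomT lemma21_torus triangle_refl_nonneg_T)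
open B8Ineq192MultiLevelTorus (geomTB geomTB_len geomT_len lenT_pos symmT)
open B6RandomWalk (HasMajorant hasMajorant_mono delta3 delta3_pos BlockSupp)
open B6RandomWalkInputNorm (HasMajorantA NormSupp hasMajorantA_mono hasMajorantA_finsetSum normSupp_nonneg)
open B6RandomWalkInputNormChain (conj_fixedPoint hasMajorantA_affine conv_two_le_of_ineq263With)
open B6Prop26Gluing (mulOp ind ind_nonneg ind_of_mem ind_of_not_mem sum_ind_eq_card)
open B6Prop26 (fixedPoint_of_291)
open B6Lemma21Repaired (Ineq263With)
open B6Ineq261LevelGap (K261 K261_nonneg)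
open B6Eq291Generator (kFam gZero rOp eq291)
open B6Ineq2133TwoScaleV1 (onFun)
open B6GlobalChartV1 (PV domT blkV1)
open B6AgreeLapV1Chart (deltaAE_split)
open B6SectAOperatorsV1 (dE dsE dcE dcsE QE aE QsE RE BondIdx)
open B6SectAVectorModelV1 (deltaAE GE)
open B6Partition118KLevelTorusCentral (one_le_of_four_le)
open B6Prop26KLevelSkeletonV1 (hB zB ST sum_mulOp_hB_sq mulOp_zB_mul_hB mulOp_hB_mul_zB onFun_GE_mul_deltaAE)
open B6Prop26KLevelSkeletonV2 (SbigT ST_subset_SbigT hNov_SbigT_of_QbigT card_filter_mono)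
open B6Prop26KLevelAssemblyV1 (distT_nonneg)
open B6Cover236QbigOverlapV1 (card_filter_mem_QbigT_le)
open B6CubeWindowV1 (Placed Gl Ml Pl GlobalBand hagree_cube hinvl_cube band_of_global band_le one_le_of_eight_le four_le_of_five_le)
open B6Prop26DivLegKLevelV1 (len_le_of_levelGap)
open B6GradLegKLevelV1 (DV)
open B6LapLegKLevelV1 (DVa)
open B6HolderPairMemberV1 (pairOp)
open B6HolderNormV1 (holderV1 supNormV1)
open B6Cor28HolderUnifKLevelV1 (ineq2137_grad_kLevel_unif)

/-! ## §1  Gluing on the input indicator; the overlap of the reach sets -/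

section Gluing

variable {g : B6.Geometry} {X : Type} (blk : X → g.Site) {adm : (X → ℝ) → g.Site → ℝ → Prop}

open Classical in
/-- **Bounded-overlap gluing on the INPUT indicator** (*"G₀ = Σ_□ h_□G_□h_□"* read for legs whose input `h_□·D′J` lives in the reach of `□`): terms with
majorants `1_{S_□}(y′)·K(y,y′)`, a common `K ≥ 0`, every block in at most `N` sets `S_□` ⟹ the sum has the majorant `N·K`.
[cite: Balaban1984PropagatorsII, (2.91) p.239 + (2.141) p.247, bookkeeping] -/
theorem hasMajorantA_sum_overlap_in {C : Type} (Dc : Finset C) (S : C → Set g.Site) (T : C → Module.End ℝ (X → ℝ))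
    (K : g.Site → g.Site → ℝ) (hK : ∀ a b, 0 ≤ K a b)
    (hadm : ∀ (μ : X → ℝ) (y' : g.Site) (B : ℝ), adm μ y' B → 0 ≤ B)
    (hT : ∀ c ∈ Dc, HasMajorantA blk adm (T c) (fun a b => ind (S c) b * K a b))
    (N : ℕ) (hN : ∀ b : g.Site, (Dc.filter fun c => b ∈ S c).card ≤ N) :
    HasMajorantA blk adm (∑ c ∈ Dc, T c) (fun a b => N * K a b) := by
  refine hasMajorantA_mono blk (hasMajorantA_finsetSum blk Dc T _ hT) hadm fun a b => ?_
  show ∑ c ∈ Dc, ind (S c) b * K a b ≤ N * K a b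
  rw [← Finset.sum_mul, sum_ind_eq_card]
  exact mul_le_mul_of_nonneg_right (by exact_mod_cast hN b) (hK a b)

end Gluing

section Overlap

variable {d ℓ : ℕ} {Mh k R : ℕ} {P' : Fin (d + 1) → ℕ} (D : TDomains d ℓ Mh k P' R)

open Classical in
/-- **EVERY TORUS BLOCK LIES IN AT MOST `3·9^{d+1}` OF THE REACH SETS `Q^T_□`** (`□⁺ ⊆ □̃` and p21/r03's count of the `□̃`).
[cite: Balaban1984PropagatorsII, (2.36) p.229, p.235, p.239, bookkeeping] -/
theorem card_filter_ST_le (hL : Odd (ℓ + 1) ∧ 1 < ℓ + 1) (hMh : 2 ≤ Mh) (hR2 : 2 * (ℓ + 1) ^ 2 ≤ R) (hMh1 : 1 ≤ Mh) (hP4 : ∀ μ, 4 ≤ P' μ)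
    (b : (geomT D).Site) : (Finset.univ.filter fun c : ↥(cubes D.toDomains) => b ∈ ST D hMh1 hP4 c).card ≤ 3 * 9 ^ (d + 1) :=
  card_filter_mono Finset.univ (fun c _ => ST_subset_SbigT D hMh1 hP4 c)
    (hNov_SbigT_of_QbigT D hMh1 hP4 (fun a => card_filter_mem_QbigT_le D hL hMh hR2 hMh1 hP4 a)) b

end Overlap

/-! ## §2  The walk `P·G·D′ = P·G₀·D′ + (P·G)(R·D′)` on one torus -/

section Walk

variable {d ℓ : ℕ} {hd : 1 ≤ d + 1} {hL : Odd (ℓ + 1) ∧ 1 < ℓ + 1} {m K : ℕ} {Mh k R : ℕ} {P' : Fin (d + 1) → ℕ}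

/-- rate weakening of an exponential kernel. [folklore] -/
private theorem exp_le_exp_of_rate {ρ σ u : ℝ} (h : σ ≤ ρ) (hu : 0 ≤ u) : Real.exp (-(ρ * u)) ≤ Real.exp (-(σ * u)) :=
  Real.exp_le_exp.2 (by nlinarith)

open Classical in
/-- **THE (2.141) WALK FOR `P·G·D′` ON ONE ADMISSIBLE V1 TORUS, ANY INPUT CLASS, ANY OUTER FACTORS.**  Genuine `G = Δ_a⁻¹` (`onFun (GE …)`), genuine cubes
`G_□, M_□, P_□` of `…B6CubeWindowV1` with the skeleton's `h_□, ζ_□`; `G₀ = Σ_□ h_□G_□h_□`, `R = Σ_{□,□′} K_{□,□′}G_{□′}h_{□′}` ((2.91), `eq291`), `G = G₀ + GR`.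
IF (h0) every n = 0 leg `P·(h_□G_□h_□)·D′ ≺_adm 1_{Q_□}(y′)·C₀·t·e^{−ρd_T}`, (hS) `P·G ≺ A_S·t·(L^{j(y)}|c′|⁻¹)·e^{−ρd_T}` (sup class) and (h1)
`R·D′ ≺_adm θ·(L^{j(y′)}|c′|⁻¹)⁻¹·e^{−ρd_T}`, THEN under the Lemma-2.1 budget (`N₀ + 1 ≤ R·L·M_h`, `e^{−ρ/2}L^{2(d+1)/N₀} < 1`) and the transport budget
(`τ ≥ 0`, `2 log L ≤ τ(R·L·M_h − 1)`):  `P·G·D′ ≺_adm (3·9^{d+1}·C₀ + A_S·θ·c²·L)·t·e^{−(ρ/2 − τ/2)d_T}`, `c = K261 N₀ (d+1) L 1 (ρ/2)`.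
[cite: Balaban1984PropagatorsII, Prop. 2.6 (2.138)–(2.139) p.247, (2.141) p.247, (2.91) p.239, Lemma 2.1 (2.63) p.234, (2.52) p.232] -/
theorem pairWalk_kLevel (hN : ∀ μ, N0 ℓ Mh k P' μ = (PV d ℓ m K hd hL).sitesPerDir 0) (D : TDomains d ℓ Mh k P' R) (hk : k ≤ m + K)
    (hk2 : 2 ≤ k) {a : ℕ} (hMha : Mh = (ℓ + 1) ^ a) (hM8 : 8 ≤ Mh) (hR2 : 2 * (ℓ + 1) ^ 2 ≤ R) (hP5 : ∀ μ, 5 ≤ P' μ) (_hℓ : 4 ≤ ℓ)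
    (hpl : ∀ c : ↥(cubes D.toDomains), Placed ℓ k P' c.1)
    {b₀ b₁ : ℝ} (hb₀ : 0 < b₀) (hb₁ : b₀ ≤ b₁) {cf : ℝ} (hcf : cf ≠ 0) {w : BondIdx (domT hN D hk) → ℝ} (hw : ∀ i, 0 < w i)
    (hwb : GlobalBand b₀ b₁ cf w)
    (N₀ : ℕ) (hN₀ : 0 < N₀) (hRM : N₀ + 1 ≤ R * ((ℓ + 1) * Mh)) {ρ : ℝ} (hρ : 0 < ρ)
    (hθ : Real.exp (-(1 / 2 * ρ)) * ((ℓ : ℝ) + 1) ^ ((2 * (d + 1 : ℕ) : ℝ) / N₀) < 1)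
    {τ : ℝ} (hτ : 0 ≤ τ) (habs : 2 * Real.log ((ℓ : ℝ) + 1) ≤ τ * (((R * ((ℓ + 1) * Mh) - 1 : ℕ)) : ℝ))
    (adm : (PBond (PV d ℓ m K hd hL) 0 → ℝ) → (geomT D).Site → ℝ → Prop)
    (hadm : ∀ (μ : PBond (PV d ℓ m K hd hL) 0 → ℝ) (y' : (geomT D).Site) (B : ℝ), adm μ y' B → 0 ≤ B)
    (Pp Dr : Module.End ℝ (PBond (PV d ℓ m K hd hL) 0 → ℝ)) {t C₀ AS θ : ℝ} (ht : 0 ≤ t) (hC₀ : 0 ≤ C₀) (hAS : 0 ≤ AS) (hθ₀ : 0 ≤ θ)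
    (h0 : ∀ c : ↥(cubes D.toDomains), HasMajorantA (g := geomT D) (blkV1 hN D) adm
      (Pp * (mulOp (hB hN D c) * Gl hN hk (one_le_of_eight_le hM8) (four_le_of_five_le hP5) hMha c (band_le (d := d) (ℓ := ℓ) hb₀ hb₁) (hpl c) w cf *
        mulOp (hB hN D c)) * Dr)
      (fun y y' => ind (ST D (one_le_of_eight_le hM8) (four_le_of_five_le hP5) c) y' * (C₀ * t * Real.exp (-(ρ * (geomT D).dist y y')))))
    (hS : HasMajorant (g := geomT D) (blkV1 hN D) (Pp * onFun (GE (domT hN D hk) hcf hw))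
      (fun y y' => AS * t * ((geomT D).len y * |cf|⁻¹) * Real.exp (-(ρ * (geomT D).dist y y'))))
    (h1 : HasMajorantA (g := geomT D) (blkV1 hN D) adm
      (rOp Finset.univ (onFun (dE (P := PV d ℓ m K hd hL) cf ∘ₗ (LinearMap.id - RE (domT hN D hk) cf) ∘ₗ dsE cf))
          (fun c => mulOp (hB hN D c)) (fun c => mulOp (zB hN D (one_le_of_eight_le hM8) (four_le_of_five_le hP5) c))
          (fun c => Gl hN hk (one_le_of_eight_le hM8) (four_le_of_five_le hP5) hMha c (band_le (d := d) (ℓ := ℓ) hb₀ hb₁) (hpl c) w cf)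
          (fun c => Ml hN hk (one_le_of_eight_le hM8) (four_le_of_five_le hP5) hMha c (band_le (d := d) (ℓ := ℓ) hb₀ hb₁) (hpl c) w cf)
          (fun c => Pl hN hk (one_le_of_eight_le hM8) (four_le_of_five_le hP5) hMha c (band_le (d := d) (ℓ := ℓ) hb₀ hb₁) (hpl c) w cf) * Dr)
      (fun y y' => θ * ((geomT D).len y' * |cf|⁻¹)⁻¹ * Real.exp (-(ρ * (geomT D).dist y y')))) :
    HasMajorantA (g := geomT D) (blkV1 hN D) adm (Pp * onFun (GE (domT hN D hk) hcf hw) * Dr)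
      (fun y y' => ((3 * 9 ^ (d + 1) : ℕ) * C₀ + AS * θ * K261 N₀ (d + 1) ((ℓ : ℝ) + 1) 1 (1 / 2 * ρ) ^ 2 * ((ℓ : ℝ) + 1)) * t *
        Real.exp (-((1 / 2 * ρ - τ / 2) * (geomT D).dist y y'))) := by
  -- ### the torus
  have hMh1 : 1 ≤ Mh := one_le_of_eight_le hM8
  have hP4 : ∀ μ, 4 ≤ P' μ := four_le_of_five_le hP5
  have hP : ∀ μ, 1 ≤ P' μ := one_le_of_four_le hP4
  have hMh : 2 ≤ Mh := le_trans (by norm_num) hM8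
  have hR : 2 * (ℓ + 1) ≤ R := le_trans (by nlinarith : 2 * (ℓ + 1) ≤ 2 * (ℓ + 1) ^ 2) hR2
  have ha₀ : (0 : ℝ) < b₀ / ((ℓ + 1 : ℕ) : ℝ) := by positivity
  have hdnn : ∀ y y' : (geomT D).Site, 0 ≤ (geomT D).dist y y' := distT_nonneg
  have habs_cf : 0 < |cf| := abs_pos.2 hcf
  -- ### the genuine cubes and the fixed point `G = G₀ + GR` of (2.91)/(2.141)
  set Glc : ↥(cubes D.toDomains) → Module.End ℝ (PBond (PV d ℓ m K hd hL) 0 → ℝ) :=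
    fun c => Gl hN hk hMh1 hP4 hMha c (band_le (d := d) (ℓ := ℓ) hb₀ hb₁) (hpl c) w cf with hGlc
  set Mlc : ↥(cubes D.toDomains) → Module.End ℝ (PBond (PV d ℓ m K hd hL) 0 → ℝ) :=
    fun c => Ml hN hk hMh1 hP4 hMha c (band_le (d := d) (ℓ := ℓ) hb₀ hb₁) (hpl c) w cf with hMlc
  set Plc : ↥(cubes D.toDomains) → Module.End ℝ (PBond (PV d ℓ m K hd hL) 0 → ℝ) :=
    fun c => Pl hN hk hMh1 hP4 hMha c (band_le (d := d) (ℓ := ℓ) hb₀ hb₁) (hpl c) w cf with hPlc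
  set G : Module.End ℝ (PBond (PV d ℓ m K hd hL) 0 → ℝ) := onFun (GE (domT hN D hk) hcf hw) with hG
  set G0 : Module.End ℝ (PBond (PV d ℓ m K hd hL) 0 → ℝ) := gZero Finset.univ (fun c => mulOp (hB hN D c)) Glc with hG0
  set Rr : Module.End ℝ (PBond (PV d ℓ m K hd hL) 0 → ℝ) :=
    rOp Finset.univ (onFun (dE (P := PV d ℓ m K hd hL) cf ∘ₗ (LinearMap.id - RE (domT hN D hk) cf) ∘ₗ dsE cf))
      (fun c => mulOp (hB hN D c)) (fun c => mulOp (zB hN D hMh1 hP4 c)) Glc Mlc Plc with hRr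
  have hagree : ∀ c, onFun (dcsE (P := PV d ℓ m K hd hL) cf ∘ₗ dcE cf + dE cf ∘ₗ dsE cf +
      QsE (domT hN D hk) ∘ₗ aE (domT hN D hk) w ∘ₗ QE (domT hN D hk)) * mulOp (hB hN D c) = Mlc c * mulOp (hB hN D c) :=
    fun c => hagree_cube hN hk hMh1 hP4 hMha c (band_le (d := d) (ℓ := ℓ) hb₀ hb₁) hk2 hM8 hR2 (hpl c) w hcf
      (fun i hi _ => band_of_global hN hk hMh1 hP4 c (le_of_lt hb₀) hcf w hwb i hi)
  have hinvl : ∀ c, (Mlc c - Plc c) * Glc c * mulOp (hB hN D c) = mulOp (hB hN D c) :=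
    fun c => hinvl_cube hN hk hMh1 hP4 hMha c (band_le (d := d) (ℓ := ℓ) hb₀ hb₁) ha₀ hM8 hR2 (hpl c) w hcf
  have h291 : onFun (deltaAE (domT hN D hk) cf w) * G0 = 1 - Rr := by
    rw [hG0, hRr, deltaAE_split]
    exact eq291 Finset.univ _ _ (fun c => mulOp (hB hN D c)) (fun c => mulOp (zB hN D hMh1 hP4 c)) Glc Mlc Plc
      (sum_mulOp_hB_sq hN D hMh1 hP) (fun c _ => hagree c) (fun c _ => hinvl c)
      (fun c _ => mulOp_zB_mul_hB hN D hMh hR hP4 c) (fun c _ => mulOp_hB_mul_zB hN D hMh hR hP4 c)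
  have hinv : G * onFun (deltaAE (domT hN D hk) cf w) = 1 := onFun_GE_mul_deltaAE (domT hN D hk) hcf hw
  have hfix : G = G0 + G * Rr := fixedPoint_of_291 hinv h291
  -- `P·G·D′ = P·G₀·D′ + (P·G)·(R·D′)`
  have hconj : Pp * G * Dr = Pp * G0 * Dr + Pp * G * (Rr * Dr) := conj_fixedPoint Pp Dr hfix
  -- ### the n = 0 term as the sum over cubes, glued on the input indicator
  have hT0 : Pp * G0 * Dr = ∑ c : ↥(cubes D.toDomains), Pp * (mulOp (hB hN D c) * Glc c * mulOp (hB hN D c)) * Dr := by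
    rw [hG0, gZero, Finset.mul_sum, Finset.sum_mul]
  have hK₀nn : ∀ y y' : (geomT D).Site, 0 ≤ C₀ * t * Real.exp (-(ρ * (geomT D).dist y y')) := fun y y' => by positivity
  have hglue : HasMajorantA (g := geomT D) (blkV1 hN D) adm (Pp * G0 * Dr)
      (fun y y' => ((3 * 9 ^ (d + 1) : ℕ) : ℝ) * (C₀ * t * Real.exp (-(ρ * (geomT D).dist y y')))) := by
    rw [hT0]
    exact hasMajorantA_sum_overlap_in (g := geomT D) (blkV1 hN D) Finset.univ (fun c => ST D hMh1 hP4 c)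
      (fun c => Pp * (mulOp (hB hN D c) * Glc c * mulOp (hB hN D c)) * Dr) _ hK₀nn hadm (fun c _ => h0 c) _
      (card_filter_ST_le D hL hMh hR2 hMh1 hP4)
  -- ### Lemma 2.1 (2.63) at `(ρ, ½)` and the affine step
  obtain ⟨-, -, -, h263⟩ := lemma21_torus D hMh1 hP hN₀ hRM hρ.le (by norm_num : (0 : ℝ) ≤ 1 / 2) (by norm_num : (1 : ℝ) / 2 ≤ 1) hθ
  set cK : ℝ := K261 N₀ (d + 1) ((ℓ : ℝ) + 1) 1 (1 / 2 * ρ) with hcK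
  have hK₁nn : ∀ y y' : (geomT D).Site, 0 ≤ θ * ((geomT D).len y' * |cf|⁻¹)⁻¹ * Real.exp (-(ρ * (geomT D).dist y y')) := fun y y' => by
    have := lenT_pos (D := D) y'; positivity
  have haff := hasMajorantA_affine (g := geomT D) (blkV1 hN D) hconj hglue hS h1 hK₁nn hadm
  refine hasMajorantA_mono (g := geomT D) (blkV1 hN D) haff hadm fun y y' => ?_
  -- ### the kernel: `N·C₀·t·e^{−ρd} + A_Sθ·t·(ℓ_y/ℓ_{y′})·Σe^{−ρd(y,·)}e^{−ρd(·,y′)} ≤ (N·C₀ + A_Sθc²L)·t·e^{−(ρ/2 − τ/2)d}`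
  set dd : ℝ := (geomT D).dist y y' with hdd
  have hd0 : 0 ≤ dd := hdnn y y'
  set ly : ℝ := (geomT D).len y * |cf|⁻¹ with hly
  set ly' : ℝ := (geomT D).len y' * |cf|⁻¹ with hly'
  have hly0 : 0 < ly := mul_pos (lenT_pos (D := D) y) (inv_pos.2 habs_cf)
  have hly'0 : 0 < ly' := mul_pos (lenT_pos (D := D) y') (inv_pos.2 habs_cf)
  have hcK0 : 0 ≤ cK := K261_nonneg (by positivity) zero_le_one
  -- the convolution of the two exponential kernels, (2.63) with `n = 2`
  have hconv := conv_two_le_of_ineq263With h263 y y'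
  have hsum : ∑ y'' : (geomT D).Site, AS * t * ly * Real.exp (-(ρ * (geomT D).dist y y'')) *
      (θ * ly'⁻¹ * Real.exp (-(ρ * (geomT D).dist y'' y'))) ≤
      AS * t * θ * (ly * ly'⁻¹) * (cK ^ 2 * Real.exp (-((1 - 1 / 2) * ρ * dd))) := by
    have hw0 : 0 ≤ AS * t * θ * (ly * ly'⁻¹) := by positivity
    calc ∑ y'' : (geomT D).Site, AS * t * ly * Real.exp (-(ρ * (geomT D).dist y y'')) * (θ * ly'⁻¹ * Real.exp (-(ρ * (geomT D).dist y'' y')))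
        = AS * t * θ * (ly * ly'⁻¹) * ∑ y'' : (geomT D).Site, Real.exp (-(ρ * (geomT D).dist y y'')) * Real.exp (-(ρ * (geomT D).dist y'' y')) := by
          rw [Finset.mul_sum]; exact Finset.sum_congr rfl fun _ _ => by ring
      _ ≤ AS * t * θ * (ly * ly'⁻¹) * (cK ^ 2 * Real.exp (-((1 - 1 / 2) * ρ * dd))) := mul_le_mul_of_nonneg_left hconv hw0
  -- the level-gap transport `ℓ_y/ℓ_{y′} ≤ L·e^{(τ/2)d}`
  have htr : ly * ly'⁻¹ ≤ ((ℓ : ℝ) + 1) * Real.exp (τ / 2 * dd) := by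
    have h1 := len_le_of_levelGap D hMh1 hP hτ habs y' y
    rw [symmT D y' y, geomTB_len, geomTB_len, ← geomT_len, ← geomT_len] at h1
    rw [mul_inv_le_iff₀ hly'0, hly, hly']
    calc (geomT D).len y * |cf|⁻¹ ≤ (((ℓ : ℝ) + 1) * Real.exp (τ / 2 * dd) * (geomT D).len y') * |cf|⁻¹ :=
          mul_le_mul_of_nonneg_right h1 (inv_nonneg.2 habs_cf.le)
      _ = ((ℓ : ℝ) + 1) * Real.exp (τ / 2 * dd) * ((geomT D).len y' * |cf|⁻¹) := by ring
  -- the rates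
  have hrate0 : Real.exp (-(ρ * dd)) ≤ Real.exp (-((1 / 2 * ρ - τ / 2) * dd)) := exp_le_exp_of_rate (by linarith) hd0
  have hrate1 : Real.exp (τ / 2 * dd) * Real.exp (-((1 - 1 / 2) * ρ * dd)) = Real.exp (-((1 / 2 * ρ - τ / 2) * dd)) := by
    rw [← Real.exp_add]; congr 1; ring
  set E : ℝ := Real.exp (-((1 / 2 * ρ - τ / 2) * dd)) with hE
  have hE0 : 0 ≤ E := (Real.exp_pos _).le
  have hNC : ((3 * 9 ^ (d + 1) : ℕ) : ℝ) * (C₀ * t * Real.exp (-(ρ * dd))) ≤ ((3 * 9 ^ (d + 1) : ℕ) : ℝ) * C₀ * t * E := by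
    calc ((3 * 9 ^ (d + 1) : ℕ) : ℝ) * (C₀ * t * Real.exp (-(ρ * dd))) = (((3 * 9 ^ (d + 1) : ℕ) : ℝ) * C₀ * t) * Real.exp (-(ρ * dd)) := by ring
      _ ≤ (((3 * 9 ^ (d + 1) : ℕ) : ℝ) * C₀ * t) * E := mul_le_mul_of_nonneg_left hrate0 (by positivity)
  have hSC : AS * t * θ * (ly * ly'⁻¹) * (cK ^ 2 * Real.exp (-((1 - 1 / 2) * ρ * dd))) ≤ AS * θ * cK ^ 2 * ((ℓ : ℝ) + 1) * t * E := by
    have hw1 : 0 ≤ AS * t * θ * cK ^ 2 * Real.exp (-((1 - 1 / 2) * ρ * dd)) := by positivity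
    calc AS * t * θ * (ly * ly'⁻¹) * (cK ^ 2 * Real.exp (-((1 - 1 / 2) * ρ * dd)))
        = (AS * t * θ * cK ^ 2 * Real.exp (-((1 - 1 / 2) * ρ * dd))) * (ly * ly'⁻¹) := by ring
      _ ≤ (AS * t * θ * cK ^ 2 * Real.exp (-((1 - 1 / 2) * ρ * dd))) * (((ℓ : ℝ) + 1) * Real.exp (τ / 2 * dd)) :=
          mul_le_mul_of_nonneg_left htr hw1
      _ = AS * θ * cK ^ 2 * ((ℓ : ℝ) + 1) * t * (Real.exp (τ / 2 * dd) * Real.exp (-((1 - 1 / 2) * ρ * dd))) := by ring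
      _ = AS * θ * cK ^ 2 * ((ℓ : ℝ) + 1) * t * E := by rw [hrate1]
  calc ((3 * 9 ^ (d + 1) : ℕ) : ℝ) * (C₀ * t * Real.exp (-(ρ * dd))) +
        ∑ y'' : (geomT D).Site, AS * t * ly * Real.exp (-(ρ * (geomT D).dist y y'')) * (θ * ly'⁻¹ * Real.exp (-(ρ * (geomT D).dist y'' y')))
      ≤ ((3 * 9 ^ (d + 1) : ℕ) : ℝ) * C₀ * t * E + AS * θ * cK ^ 2 * ((ℓ : ℝ) + 1) * t * E := add_le_add hNC (hsum.trans hSC)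
    _ = (((3 * 9 ^ (d + 1) : ℕ) : ℝ) * C₀ + AS * θ * cK ^ 2 * ((ℓ : ℝ) + 1)) * t * E := by ring

end Walk

/-! ## §3  The pair majorant of `∇_νG∇*_μ` on the Hölder class, census shape -/

section Census

variable {d ℓ : ℕ} {hd : 1 ≤ d + 1} {hL : Odd (ℓ + 1) ∧ 1 < ℓ + 1} {b₀ b₁ : ℝ}

/-- the budget inequality `e^{−ασ}·L^{2(d+1)/N₀} < 1` for `N₀ := ⌈2(d+1)·log L/(ασ)⌉₊ + 1` (`α, σ > 0`) — p38's private helper, re-proved. [folklore] -/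
private theorem budget_lt_one {d ℓ : ℕ} {α σ : ℝ} (hα : 0 < α) (hσ : 0 < σ) :
    Real.exp (-(α * σ)) * ((ℓ : ℝ) + 1) ^ ((2 * (d + 1 : ℕ) : ℝ) / (⌈2 * ((d : ℝ) + 1) * Real.log ((ℓ : ℝ) + 1) / (α * σ)⌉₊ + 1 : ℕ)) < 1 := by
  have hLL : (0 : ℝ) < (ℓ : ℝ) + 1 := by positivity
  have hN : 2 * ((d : ℝ) + 1) * Real.log ((ℓ : ℝ) + 1) / (α * σ) <
      ((⌈2 * ((d : ℝ) + 1) * Real.log ((ℓ : ℝ) + 1) / (α * σ)⌉₊ + 1 : ℕ) : ℝ) := by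
    push_cast
    exact lt_of_le_of_lt (Nat.le_ceil _) (lt_add_one _)
  have hNpos : (0 : ℝ) < ((⌈2 * ((d : ℝ) + 1) * Real.log ((ℓ : ℝ) + 1) / (α * σ)⌉₊ + 1 : ℕ) : ℝ) := by positivity
  have hασ : 0 < α * σ := mul_pos hα hσ
  have key : (2 * (d + 1 : ℕ) : ℝ) / (⌈2 * ((d : ℝ) + 1) * Real.log ((ℓ : ℝ) + 1) / (α * σ)⌉₊ + 1 : ℕ) * Real.log ((ℓ : ℝ) + 1) < α * σ := by
    rw [div_mul_eq_mul_div, div_lt_iff₀ hNpos]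
    rw [div_lt_iff₀ hασ] at hN
    push_cast at hN ⊢
    nlinarith
  rw [Real.rpow_def_of_pos hLL, ← Real.exp_add, Real.exp_lt_one_iff]
  nlinarith

/-- the transport condition `2 log L ≤ τ·(R·L·M_h − 1)` from `⌈2 log L/τ⌉₊ ≤ N` and `N + 1 ≤ R·L·M_h` (`τ > 0`) — p38's private helper, re-proved. [folklore] -/
private theorem transport_of_le {ℓ Mh R N : ℕ} {τ : ℝ} (hτ : 0 < τ) (hN : ⌈2 * Real.log ((ℓ : ℝ) + 1) / τ⌉₊ ≤ N)
    (hRM : N + 1 ≤ R * ((ℓ + 1) * Mh)) : 2 * Real.log ((ℓ : ℝ) + 1) ≤ τ * (((R * ((ℓ + 1) * Mh) - 1 : ℕ)) : ℝ) := by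
  have h1 : 2 * Real.log ((ℓ : ℝ) + 1) / τ ≤ (N : ℝ) := (Nat.le_ceil _).trans (by exact_mod_cast hN)
  have h2 : (N : ℝ) ≤ (((R * ((ℓ + 1) * Mh) - 1 : ℕ)) : ℝ) := by exact_mod_cast (by omega : N ≤ R * ((ℓ + 1) * Mh) - 1)
  rw [div_le_iff₀ hτ] at h1
  nlinarith

open Classical in
/-- **THE PAIR MAJORANT OF `∇_νG∇*_μ` ON THE HÖLDER CLASS `‖·‖_{α+ε} + |·|`, CENSUS SHAPE** (the input `hp4` of
`…B6Prop26Census2139KLevelV1.prop26_census2139_kLevel_of_pair`, CHARACTER FOR CHARACTER): ONE rate, ONE pair of thresholds for the band, and for every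
`0 ≤ α`, `0 < ε`, `α + ε < 1` a constant `A` with `P_{x,x′}·∇_νG∇*_μ ≺_adm A·t^α·e^{−δd_T}` on every admissible ordered pair of every admissible V1 torus —
from the walk `pairWalk_kLevel` with the left letter (2.137)₁ BY NAME (`ineq2137_grad_kLevel_unif`) and the two DISPLAYED k-level inputs (hlegs0) = the
per-cube Hölder-output n = 0 legs on the class, (hlast) = the last legs `R·∇*_μ` on the class `‖·‖_{ε′} + |·|`.
[cite: Balaban1984PropagatorsII, Prop. 2.6 (2.139) p.247, (2.137) p.247, (2.141) p.247, (2.91) p.239, Lemma 2.1 p.234; Balaban1984PropagatorsI, (1.109) p.35] -/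
theorem holderGrad2_pair_kLevel_census (hb₀ : 0 < b₀) (hb₁ : b₀ ≤ b₁)
    (hlegs0 : ∃ ρ₀ : ℝ, 0 < ρ₀ ∧ ∀ (α ε : ℝ), 0 ≤ α → 0 < ε → α + ε < 1 → ∃ C : ℝ, 0 ≤ C ∧
      ∀ (m K : ℕ) {Mh k R : ℕ} {P' : Fin (d + 1) → ℕ}
        (hN : ∀ μ, N0 ℓ Mh k P' μ = (PV d ℓ m K hd hL).sitesPerDir 0) (D : TDomains d ℓ Mh k P' R) (hk : k ≤ m + K)
        (hMh1 : 1 ≤ Mh) (hP4 : ∀ μ, 4 ≤ P' μ) {a : ℕ} (hMha : Mh = (ℓ + 1) ^ a) (_ : 8 ≤ Mh) (_ : 2 * (ℓ + 1) ^ 2 ≤ R) (_ : ∀ μ, 5 ≤ P' μ)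
        (_ : 4 ≤ ℓ) (c : ↥(cubes D.toDomains)) (hpl : Placed ℓ k P' c.1) (w : BondIdx (domT hN D hk) → ℝ) {cf : ℝ} (_ : cf ≠ 0)
        (ν μ : Fin (d + 1)) (x x' : PBond (PV d ℓ m K hd hL) 0), x.dir = x'.dir →
        supDist x.src x'.src ≤ (ℓ + 1) ^ (blkV1 hN D x).1.1 → supDist x.src x'.src ≤ (ℓ + 1) ^ (blkV1 hN D x').1.1 →
        HasMajorantA (g := geomT D) (blkV1 hN D)
          (NormSupp (g := geomT D) (blkV1 hN D) (fun y' => ({y'} : Set (geomT D).Site)) (fun _ J => holderV1 hN D (α + ε) J + supNormV1 J))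
          (pairOp x x' * (DV (P := PV d ℓ m K hd hL) ν cf *
            (mulOp (hB hN D c) * Gl hN hk hMh1 hP4 hMha c (band_le (d := d) (ℓ := ℓ) hb₀ hb₁) hpl w cf * mulOp (hB hN D c)) *
            DVa (P := PV d ℓ m K hd hL) μ cf))
          (fun y y' => ind (ST D hMh1 hP4 c) y' * (C * ((((supDist x.src x'.src : ℕ) : ℝ) / (((ℓ + 1 : ℕ) : ℝ)) ^ (blkV1 hN D x).1.1) ^ α) *
            Real.exp (-(ρ₀ * (geomT D).dist y y')))))
    (hlast : ∃ (σ₀ M₀ : ℝ) (N' : ℕ), 0 < σ₀ ∧ 0 < M₀ ∧ ∀ (ε' : ℝ), 0 < ε' → ε' < 1 → ∃ θ : ℝ, 0 ≤ θ ∧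
      ∀ (m K : ℕ) {Mh k R : ℕ} {P' : Fin (d + 1) → ℕ}
        (hN : ∀ μ, N0 ℓ Mh k P' μ = (PV d ℓ m K hd hL).sitesPerDir 0) (D : TDomains d ℓ Mh k P' R) (hk : k ≤ m + K) (_ : 2 ≤ k)
        {a : ℕ} (hMha : Mh = (ℓ + 1) ^ a) (hM8 : 8 ≤ Mh) (_ : 2 * (ℓ + 1) ^ 2 ≤ R) (hP5 : ∀ μ, 5 ≤ P' μ) (_ : 4 ≤ ℓ)
        (hpl : ∀ c : ↥(cubes D.toDomains), Placed ℓ k P' c.1) (_ : M₀ ≤ ((ℓ : ℝ) + 1) * Mh) (_ : N' + 1 ≤ R * ((ℓ + 1) * Mh))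
        {cf : ℝ} (hcf : cf ≠ 0) {w : BondIdx (domT hN D hk) → ℝ} (hw : ∀ i, 0 < w i) (_ : GlobalBand b₀ b₁ cf w) (μ : Fin (d + 1)),
        HasMajorantA (g := geomT D) (blkV1 hN D)
          (NormSupp (g := geomT D) (blkV1 hN D) (fun y' => ({y'} : Set (geomT D).Site)) (fun _ J => holderV1 hN D ε' J + supNormV1 J))
          (rOp Finset.univ (onFun (dE (P := PV d ℓ m K hd hL) cf ∘ₗ (LinearMap.id - RE (domT hN D hk) cf) ∘ₗ dsE cf))
              (fun c => mulOp (hB hN D c)) (fun c => mulOp (zB hN D (one_le_of_eight_le hM8) (four_le_of_five_le hP5) c))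
              (fun c => Gl hN hk (one_le_of_eight_le hM8) (four_le_of_five_le hP5) hMha c (band_le (d := d) (ℓ := ℓ) hb₀ hb₁) (hpl c) w cf)
              (fun c => Ml hN hk (one_le_of_eight_le hM8) (four_le_of_five_le hP5) hMha c (band_le (d := d) (ℓ := ℓ) hb₀ hb₁) (hpl c) w cf)
              (fun c => Pl hN hk (one_le_of_eight_le hM8) (four_le_of_five_le hP5) hMha c (band_le (d := d) (ℓ := ℓ) hb₀ hb₁) (hpl c) w cf) *
            DVa (P := PV d ℓ m K hd hL) μ cf)
          (fun y y' => θ * ((geomT D).len y' * |cf|⁻¹)⁻¹ * Real.exp (-(σ₀ * (geomT D).dist y y')))) :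
    ∃ (δ M₂ : ℝ) (N₁ : ℕ), 0 < δ ∧ 0 < M₂ ∧ ∀ (α ε : ℝ), 0 ≤ α → 0 < ε → α + ε < 1 → ∃ A : ℝ, 0 ≤ A ∧
      ∀ (m K : ℕ) {Mh k R : ℕ} {P' : Fin (d + 1) → ℕ}
        (hN : ∀ μ, N0 ℓ Mh k P' μ = (PV d ℓ m K hd hL).sitesPerDir 0) (D : TDomains d ℓ Mh k P' R) (hk : k ≤ m + K) (_ : 2 ≤ k)
        {a : ℕ} (_ : Mh = (ℓ + 1) ^ a) (_ : 8 ≤ Mh) (_ : 2 * (ℓ + 1) ^ 2 ≤ R) (_ : ∀ μ, 5 ≤ P' μ) (_ : 4 ≤ ℓ)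
        (_ : ∀ c : ↥(cubes D.toDomains), Placed ℓ k P' c.1) (_ : M₂ ≤ ((ℓ : ℝ) + 1) * Mh) (_ : N₁ + 1 ≤ R * ((ℓ + 1) * Mh))
        {cf : ℝ} (hcf : cf ≠ 0) {w : BondIdx (domT hN D hk) → ℝ} (hw : ∀ i, 0 < w i) (_ : GlobalBand b₀ b₁ cf w)
        (ν μ : Fin (d + 1)) (x x' : PBond (PV d ℓ m K hd hL) 0), x.dir = x'.dir →
        supDist x.src x'.src ≤ (ℓ + 1) ^ (blkV1 hN D x).1.1 → supDist x.src x'.src ≤ (ℓ + 1) ^ (blkV1 hN D x').1.1 →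
        HasMajorantA (g := geomT D) (blkV1 hN D)
          (NormSupp (g := geomT D) (blkV1 hN D) (fun y' => ({y'} : Set (geomT D).Site)) (fun _ J => holderV1 hN D (α + ε) J + supNormV1 J))
          (pairOp x x' * (DV (P := PV d ℓ m K hd hL) ν cf * onFun (GE (domT hN D hk) hcf hw) * DVa μ cf))
          (fun y y' => A * ((((supDist x.src x'.src : ℕ) : ℝ) / (((ℓ + 1 : ℕ) : ℝ)) ^ (blkV1 hN D x).1.1) ^ α) *
            Real.exp (-(δ * (geomT D).dist y y'))) := by
  -- the left letter (2.137)₁ by name, Lemma-2.1 exponent `½`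
  obtain ⟨σ₁, hσ₁, hF⟩ := ineq2137_grad_kLevel_unif d ℓ hd hL hb₀ hb₁
  obtain ⟨MS, hMS, hF2⟩ := hF σ₁ hσ₁ le_rfl (1 / 2) (by norm_num) (by norm_num)
  clear hF
  have hδS : 0 < delta3 (1 / 2) (2 * σ₁) := delta3_pos (by norm_num) (by linarith)
  obtain ⟨ρ₀, hρ₀, hL0⟩ := hlegs0
  obtain ⟨σ₀, M₀, N', hσ₀, hM₀, hL1⟩ := hlast
  -- the common rate, the budgets
  set ρ : ℝ := min (delta3 (1 / 2) (2 * σ₁)) (min ρ₀ σ₀) with hρ_def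
  have hρ : 0 < ρ := lt_min hδS (lt_min hρ₀ hσ₀)
  have hρS : ρ ≤ delta3 (1 / 2) (2 * σ₁) := min_le_left _ _
  have hρ0 : ρ ≤ ρ₀ := (min_le_right _ _).trans (min_le_left _ _)
  have hρ1 : ρ ≤ σ₀ := (min_le_right _ _).trans (min_le_right _ _)
  set N₀ : ℕ := ⌈2 * ((d : ℝ) + 1) * Real.log ((ℓ : ℝ) + 1) / (1 / 2 * ρ)⌉₊ + 1 with hN₀_def
  have hN₀ : 0 < N₀ := Nat.succ_pos _
  set Nτ : ℕ := ⌈2 * Real.log ((ℓ : ℝ) + 1) / (ρ / 2)⌉₊ with hNτ_def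
  refine ⟨ρ / 4, max MS M₀, max (max N₀ Nτ) N', by positivity, lt_max_of_lt_left hMS, fun α ε hα0 hε0 hαε => ?_⟩
  have hα1 : α < 1 := by linarith
  have hε'0 : 0 < α + ε := by linarith
  obtain ⟨AS, hAS, hS⟩ := hF2 α hα0 hα1
  obtain ⟨C₀, hC₀, h0⟩ := hL0 α ε hα0 hε0 hαε
  obtain ⟨θ, hθ0, h1⟩ := hL1 (α + ε) hε'0 hαε
  set cK : ℝ := K261 N₀ (d + 1) ((ℓ : ℝ) + 1) 1 (1 / 2 * ρ) with hcK
  have hcK0 : 0 ≤ cK := K261_nonneg (by positivity) zero_le_one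
  have hA0 : 0 ≤ ((3 * 9 ^ (d + 1) : ℕ) : ℝ) * C₀ + AS * θ * cK ^ 2 * ((ℓ : ℝ) + 1) := by positivity
  refine ⟨((3 * 9 ^ (d + 1) : ℕ) : ℝ) * C₀ + AS * θ * cK ^ 2 * ((ℓ : ℝ) + 1), hA0, ?_⟩
  intro m K Mh k R P' hN D hk hk2 a hMha hM8 hR2 hP5 hℓ hpl hLM hRM cf hcf w hw hwb ν μ x x' hdir hs1 hs2
  have hMh1 : 1 ≤ Mh := one_le_of_eight_le hM8
  have hP4 : ∀ μ, 4 ≤ P' μ := four_le_of_five_le hP5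
  have hdnn : ∀ y y' : (geomT D).Site, 0 ≤ (geomT D).dist y y' := distT_nonneg
  -- thresholds of this torus
  have hLMS : MS ≤ ((ℓ : ℝ) + 1) * Mh := (le_max_left _ _).trans hLM
  have hLM0 : M₀ ≤ ((ℓ : ℝ) + 1) * Mh := (le_max_right _ _).trans hLM
  have hRM0 : N₀ + 1 ≤ R * ((ℓ + 1) * Mh) := le_trans (Nat.succ_le_succ ((le_max_left _ _).trans (le_max_left _ _))) hRM
  have hRM' : N' + 1 ≤ R * ((ℓ + 1) * Mh) := le_trans (Nat.succ_le_succ (le_max_right _ _)) hRM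
  have hθb := budget_lt_one (d := d) (ℓ := ℓ) (α := 1 / 2) (σ := ρ) (by norm_num) hρ
  have hτ' := transport_of_le (Mh := Mh) (R := R) (by positivity : (0 : ℝ) < ρ / 2) ((le_max_right _ _).trans (le_max_left _ _)) hRM
  -- the pair weight
  set t : ℝ := (((supDist x.src x'.src : ℕ) : ℝ) / (((ℓ + 1 : ℕ) : ℝ)) ^ (blkV1 hN D x).1.1) ^ α with ht
  have ht0 : 0 ≤ t := Real.rpow_nonneg (by positivity) _
  -- the three inputs at the common rate `ρ`
  have hrate : ∀ {σ : ℝ} (_ : ρ ≤ σ) (y y' : (geomT D).Site), Real.exp (-(σ * (geomT D).dist y y')) ≤ Real.exp (-(ρ * (geomT D).dist y y')) :=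
    fun hσ y y' => Real.exp_le_exp.2 (neg_le_neg (mul_le_mul_of_nonneg_right hσ (hdnn y y')))
  have hadm := normSupp_nonneg (g := geomT D) (blkV1 hN D) (R := fun y' => ({y'} : Set (geomT D).Site))
    (N := fun _ J => holderV1 hN D (α + ε) J + supNormV1 J)
  have h0' : ∀ c : ↥(cubes D.toDomains), HasMajorantA (g := geomT D) (blkV1 hN D)
      (NormSupp (g := geomT D) (blkV1 hN D) (fun y' => ({y'} : Set (geomT D).Site)) (fun _ J => holderV1 hN D (α + ε) J + supNormV1 J))
      ((pairOp x x' * DV (P := PV d ℓ m K hd hL) ν cf) *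
        (mulOp (hB hN D c) * Gl hN hk hMh1 hP4 hMha c (band_le (d := d) (ℓ := ℓ) hb₀ hb₁) (hpl c) w cf * mulOp (hB hN D c)) *
        DVa (P := PV d ℓ m K hd hL) μ cf)
      (fun y y' => ind (ST D hMh1 hP4 c) y' * (C₀ * t * Real.exp (-(ρ * (geomT D).dist y y')))) := by
    intro c
    have h := h0 m K hN D hk hMh1 hP4 hMha hM8 hR2 hP5 hℓ c (hpl c) w hcf ν μ x x' hdir hs1 hs2
    have e : pairOp x x' * (DV (P := PV d ℓ m K hd hL) ν cf *
        (mulOp (hB hN D c) * Gl hN hk hMh1 hP4 hMha c (band_le (d := d) (ℓ := ℓ) hb₀ hb₁) (hpl c) w cf * mulOp (hB hN D c)) *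
        DVa (P := PV d ℓ m K hd hL) μ cf) =
        (pairOp x x' * DV (P := PV d ℓ m K hd hL) ν cf) *
        (mulOp (hB hN D c) * Gl hN hk hMh1 hP4 hMha c (band_le (d := d) (ℓ := ℓ) hb₀ hb₁) (hpl c) w cf * mulOp (hB hN D c)) *
        DVa (P := PV d ℓ m K hd hL) μ cf := by simp only [mul_assoc]
    rw [e] at h
    refine hasMajorantA_mono (g := geomT D) (blkV1 hN D) h hadm fun y y' => ?_
    exact mul_le_mul_of_nonneg_left (mul_le_mul_of_nonneg_left (hrate hρ0 y y') (by positivity)) (ind_nonneg _ _)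
  have hS' : HasMajorant (g := geomT D) (blkV1 hN D) ((pairOp x x' * DV (P := PV d ℓ m K hd hL) ν cf) * onFun (GE (domT hN D hk) hcf hw))
      (fun y y' => AS * t * ((geomT D).len y * |cf|⁻¹) * Real.exp (-(ρ * (geomT D).dist y y'))) := by
    have h := hS m K hN D hk hk2 hMha hM8 hR2 hP5 hℓ hpl hLMS hcf hw hwb ν x x' hdir hs1 hs2
    refine hasMajorant_mono _ h fun y y' => ?_
    have hl : 0 ≤ (geomT D).len y * |cf|⁻¹ := mul_nonneg (lenT_pos (D := D) y).le (inv_nonneg.2 (abs_nonneg _))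
    calc AS * (t * ((geomT D).len y * |cf|⁻¹)) * Real.exp (-(delta3 (1 / 2) (2 * σ₁) * (geomT D).dist y y'))
        ≤ AS * (t * ((geomT D).len y * |cf|⁻¹)) * Real.exp (-(ρ * (geomT D).dist y y')) :=
          mul_le_mul_of_nonneg_left (hrate hρS y y') (by positivity)
      _ = AS * t * ((geomT D).len y * |cf|⁻¹) * Real.exp (-(ρ * (geomT D).dist y y')) := by ring
  have h1' := h1 m K hN D hk hk2 hMha hM8 hR2 hP5 hℓ hpl hLM0 hRM' hcf hw hwb μ
  have h1'' : HasMajorantA (g := geomT D) (blkV1 hN D)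
      (NormSupp (g := geomT D) (blkV1 hN D) (fun y' => ({y'} : Set (geomT D).Site)) (fun _ J => holderV1 hN D (α + ε) J + supNormV1 J))
      (rOp Finset.univ (onFun (dE (P := PV d ℓ m K hd hL) cf ∘ₗ (LinearMap.id - RE (domT hN D hk) cf) ∘ₗ dsE cf))
          (fun c => mulOp (hB hN D c)) (fun c => mulOp (zB hN D hMh1 hP4 c))
          (fun c => Gl hN hk hMh1 hP4 hMha c (band_le (d := d) (ℓ := ℓ) hb₀ hb₁) (hpl c) w cf)
          (fun c => Ml hN hk hMh1 hP4 hMha c (band_le (d := d) (ℓ := ℓ) hb₀ hb₁) (hpl c) w cf)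
          (fun c => Pl hN hk hMh1 hP4 hMha c (band_le (d := d) (ℓ := ℓ) hb₀ hb₁) (hpl c) w cf) * DVa (P := PV d ℓ m K hd hL) μ cf)
      (fun y y' => θ * ((geomT D).len y' * |cf|⁻¹)⁻¹ * Real.exp (-(ρ * (geomT D).dist y y'))) := by
    refine hasMajorantA_mono (g := geomT D) (blkV1 hN D) h1' hadm fun y y' => ?_
    have hl : 0 ≤ ((geomT D).len y' * |cf|⁻¹)⁻¹ := inv_nonneg.2 (mul_nonneg (lenT_pos (D := D) y').le (inv_nonneg.2 (abs_nonneg _)))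
    exact mul_le_mul_of_nonneg_left (hrate hρ1 y y') (by positivity)
  -- the walk
  have hmain := pairWalk_kLevel hN D hk hk2 hMha hM8 hR2 hP5 hℓ hpl hb₀ hb₁ hcf hw hwb N₀ hN₀ hRM0 hρ hθb (τ := ρ / 2) (by positivity) hτ'
    _ hadm (pairOp x x' * DV (P := PV d ℓ m K hd hL) ν cf) (DVa (P := PV d ℓ m K hd hL) μ cf) ht0 hC₀ hAS hθ0 h0' hS' h1''
  have e : pairOp x x' * (DV (P := PV d ℓ m K hd hL) ν cf * onFun (GE (domT hN D hk) hcf hw) * DVa μ cf) =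
      pairOp x x' * DV (P := PV d ℓ m K hd hL) ν cf * onFun (GE (domT hN D hk) hcf hw) * DVa (P := PV d ℓ m K hd hL) μ cf := by
    simp only [mul_assoc]
  rw [e]
  refine hasMajorantA_mono (g := geomT D) (blkV1 hN D) hmain hadm fun y y' => le_of_eq ?_
  rw [show (1 : ℝ) / 2 * ρ - ρ / 2 / 2 = ρ / 4 by ring]

end Census

end Literature.MathematicalPhysics.QuantumFieldTheory.Balaban1983to89.B6Prop26HolderGrad2KLevelV1

end
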